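import Literature.MathematicalPhysics.PowerSystems.ChiangThreeMachineEquilibriumCensus
import Literature.MathematicalPhysics.PowerSystems.FiniteEquilibriumSetIsolation
import HarnessLib

/-!
# Chiang3PrintedPointConvergence — Chiang's Thm 3.1 (bounded branch) for HIS OWN three-machine example with NO isolation
# hypothesis: the PRINTED system (4.1) typed as lit-6's `LosslessSystem 2 1`, its equilibrium predicate identified with lit-1's
# census predicate, and point convergence of every bounded motion

Venture GRIDFUSION (LADDER-GRIDFUSION; lead g8 RULING 9bq (5) «model-1 bridge lemma ≈ 10 lines — GO LOW as default work» on lit-1 g10's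
offer 20:14:56Z / 20:15:06Z; seat gridfusion-model-1 g8).

PROVENANCE POINT (why the bridge is NOT stated on model-1's `Chiang3.data`): model-1's G1.a′ object `Chiang3.data` (p464911) carries the
A1 eq=b REDISPATCHED injections `P′ = (−3532224516/59313888374669379601, 2965694417566285728/59313888374669379601)` (floats
`(−6.0e−11, 0.04999999998)`, `Models/Chiang3.lean` docstring; MODELLED «MV-2L+MV-P») so that its s.e.p. is an exact rational circle point —
whereas lit-1's kernel census `ChiangThreeMachine.finite_equilibria_periodBox_pi` (p566261) is for the PRINTED injections `(0, 1/20)` of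
[Chiang1995, §4.1 eq. (4.1)].  The two equilibrium predicates differ by `≈ 1e−11` in the constants, so «`Chiang3.data`'s equilibria ↔ the census
predicate» is FALSE as an `Iff`.  This file therefore types the PRINTED system itself (`printedSystem`, a `LosslessSystem 2 1` with the printed
numbers — node order of `Chiang3.data`: machines 1, 2 ↦ indices 0, 1, bus at angle 0) and proves the bridge and the corollaries for it; a census
for the redispatched `P′` (same `n = 2` search with two literals changed) would give the same corollaries for `Chiang3.data` — not done here.

CONTENTS: `printedSystem`; `printedSystem_field_fst/_snd_zero/_snd_one` (its field IS (4.1) verbatim, cf. lit-6 `ChiangThreeMachine.field`);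
`printedSystem_isEquilibrium_iff` (THE BRIDGE: `printedSystem.IsEquilibrium θ ↔ ChiangThreeMachine.IsEquilibrium (θ 0, θ 1)`);
`printedSystem_finite_equilibria` (lit-1's census transported); COROLLARIES by name from lit-1's `FiniteEquilibriumSetIsolation`
(p562577): `printed_tendsto_equilibrium_of_bounded` (every forward motion confined to a compact set converges to ONE equilibrium point
`(θe, 0)`), `printed_tendsto_equilibrium_of_angles_bounded` (bounded rotor angles suffice), `printed_dichotomy` (every forward motion
converges to an equilibrium point or leaves every compact set) — Chiang's Thm 3.1 for (4.1) with the isolation hypothesis DISCHARGED by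
the kernel census (exactly six equilibria modulo 2π).
THREE COLUMNS.  CERTIFIED: the statements below for MODEL (4.1) as printed (classical lossless three-machine system with machine 3 as
infinite bus, uniform unit inertias, dampings 0.4 / 0.5).  VALIDATED / MODELLED: nothing new; «stable» is asserted of nothing — the
corollaries say where bounded motions GO, not that motions are bounded.  One definition (`printedSystem`, bookkeeping); no named fact;
standard axioms.  [cite: Chiang1995, §3 Thm 3.1, §4.1 eq. (4.1) and Table 4.1]
-/

noncomputable section

open Set Filter Topology
open Literature.MathematicalPhysics.PowerSystems

namespace Summit.Ventures.GridStability.Models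

namespace Chiang3

/-- THE PRINTED three-machine system (4.1) as a `LosslessSystem 2 1`: `M = (1, 1)`, `D = (2/5, 1/2)`, `P = (0, 1/20)` (PRINTED, not
model-1's redispatched `P′`), `C₁₂ = C₂₁ = 1/2` (zero diagonal), bus couplings `K = (1, 1/2)`, bus angle `0`.
[cite: Chiang1995, §4.1 eq. (4.1)] -/
def printedSystem : ClassicalModel.LosslessSystem 2 1 where
  M := ![1, 1]
  D := ![2 / 5, 1 / 2]
  P := ![0, 1 / 20]
  C := fun i j => if i = j then 0 else 1 / 2
  K := ![fun _ => 1, fun _ => 1 / 2]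
  β := fun _ => 0

/-- The flows of the printed system: `flow θ 0 = ½ sin(θ₀ − θ₁) + sin θ₀`, `flow θ 1 = ½ sin(θ₁ − θ₀) + ½ sin θ₁`. -/
theorem printedSystem_flow (θ : Fin 2 → ℝ) :
    printedSystem.flow θ 0 = 1 / 2 * Real.sin (θ 0 - θ 1) + Real.sin (θ 0) ∧
      printedSystem.flow θ 1 = 1 / 2 * Real.sin (θ 1 - θ 0) + 1 / 2 * Real.sin (θ 1) := by
  simp [ClassicalModel.LosslessSystem.flow, printedSystem, Fin.sum_univ_two]

/-- The angle equation of the printed field is `θ̇ = ω`. [cite: Chiang1995, §4.1 eq. (4.1)] -/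
theorem printedSystem_field_fst (x : (Fin 2 → ℝ) × (Fin 2 → ℝ)) : (printedSystem.field x).1 = x.2 := rfl

/-- First speed equation `ω̇₁ = −sin δ₁ − ½ sin(δ₁ − δ₂) − 0.4 ω₁` — (4.1) verbatim (cf. lit-6 `ChiangThreeMachine.field`).
[cite: Chiang1995, §4.1 eq. (4.1)] -/
theorem printedSystem_field_snd_zero (x : (Fin 2 → ℝ) × (Fin 2 → ℝ)) :
    (printedSystem.field x).2 0 = -Real.sin (x.1 0) - 1 / 2 * Real.sin (x.1 0 - x.1 1) - 2 / 5 * x.2 0 := by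
  have h := (printedSystem_flow x.1).1
  simp only [ClassicalModel.LosslessSystem.field] at *
  rw [h]
  simp [printedSystem]
  ring

/-- Second speed equation `ω̇₂ = −½ sin δ₂ − ½ sin(δ₂ − δ₁) − 0.5 ω₂ + 0.05` — (4.1) verbatim. [cite: Chiang1995, §4.1 eq. (4.1)] -/
theorem printedSystem_field_snd_one (x : (Fin 2 → ℝ) × (Fin 2 → ℝ)) :
    (printedSystem.field x).2 1 =
      -(1 / 2) * Real.sin (x.1 1) - 1 / 2 * Real.sin (x.1 1 - x.1 0) - 1 / 2 * x.2 1 + 1 / 20 := by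
  have h := (printedSystem_flow x.1).2
  simp only [ClassicalModel.LosslessSystem.field] at *
  rw [h]
  simp [printedSystem]
  ring

/-- **THE BRIDGE**: the printed system's equilibrium predicate IS lit-1's census predicate. [cite: Chiang1995, §4.1 eq. (4.1)] -/
theorem printedSystem_isEquilibrium_iff (θ : Fin 2 → ℝ) :
    printedSystem.IsEquilibrium θ ↔ ChiangThreeMachine.IsEquilibrium (θ 0, θ 1) := by
  have hf := printedSystem_flow θ
  simp only [ClassicalModel.LosslessSystem.IsEquilibrium, Fin.forall_fin_two, hf.1, hf.2, ChiangThreeMachine.IsEquilibrium]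
  simp only [printedSystem, Matrix.cons_val_zero, Matrix.cons_val_one]
  constructor
  · rintro ⟨h0, h1⟩
    exact ⟨by linarith, by linarith⟩
  · rintro ⟨h0, h1⟩
    exact ⟨by linarith, by linarith⟩

/-- The machine–machine couplings of the printed system are symmetric. -/
theorem printedSystem_C_symm : ∀ i j, printedSystem.C i j = printedSystem.C j i := by
  intro i j
  simp only [printedSystem]
  by_cases h : i = j
  · subst h; rfl
  · rw [if_neg h, if_neg (Ne.symm h)]

/-- Positive inertias. -/
theorem printedSystem_M_pos : ∀ i, 0 < printedSystem.M i := by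
  intro i; fin_cases i <;> simp [printedSystem]

/-- Positive dampings. -/
theorem printedSystem_D_pos : ∀ i, 0 < printedSystem.D i := by
  intro i; fin_cases i <;> simp [printedSystem]

/-- **lit-1's census transported**: the printed system has finitely many equilibrium angle vectors in the period box `[−π, π]²`
(exactly six, `ChiangThreeMachine.equilibria_mod_two_pi`). [cite: Chiang1995, §4.1 Table 4.1] -/
theorem printedSystem_finite_equilibria :
    {θ : Fin 2 → ℝ | (∀ i, θ i ∈ Icc (-Real.pi) Real.pi) ∧ printedSystem.IsEquilibrium θ}.Finite := by
  have h := ChiangThreeMachine.finite_equilibria_periodBox_pi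
  refine h.subset ?_
  rintro θ ⟨hb, he⟩
  exact ⟨hb, (printedSystem_isEquilibrium_iff θ).1 he⟩

/-- **Chiang's Thm 3.1 (bounded branch) for his own example, NO isolation hypothesis**: every forward motion of the printed system (4.1)
confined to a compact set converges to ONE equilibrium point `(θe, 0)`, `θe` a solution of the printed power balance.
[cite: Chiang1995, §3 Thm 3.1, §4.1] -/
theorem printed_tendsto_equilibrium_of_bounded {X : ℝ → (Fin 2 → ℝ) × (Fin 2 → ℝ)}
    (hX : ∀ T : ℝ, ∀ t ∈ Icc 0 T, HasDerivWithinAt X (printedSystem.field (X t)) (Icc 0 T) t)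
    {K : Set ((Fin 2 → ℝ) × (Fin 2 → ℝ))} (hK : IsCompact K) (hXK : ∀ t, 0 ≤ t → X t ∈ K) :
    ∃ θe : Fin 2 → ℝ, ChiangThreeMachine.IsEquilibrium (θe 0, θe 1) ∧ Tendsto X atTop (𝓝 (θe, 0)) := by
  obtain ⟨θe, he, h⟩ := printedSystem.tendsto_equilibrium_of_bounded_of_finite printedSystem_C_symm printedSystem_M_pos
    printedSystem_D_pos printedSystem_finite_equilibria hX hK hXK
  exact ⟨θe, (printedSystem_isEquilibrium_iff θe).1 he, h⟩

/-- **Bounded rotor angles suffice** (the bus is an infinite bus): every forward motion of (4.1) with bounded angles converges to ONE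
equilibrium point. [cite: Chiang1995, §3 Thm 3.1; SauerPai1998, §9.5] -/
theorem printed_tendsto_equilibrium_of_angles_bounded {X : ℝ → (Fin 2 → ℝ) × (Fin 2 → ℝ)}
    (hX : ∀ T : ℝ, ∀ t ∈ Icc 0 T, HasDerivWithinAt X (printedSystem.field (X t)) (Icc 0 T) t)
    {B : ℝ} (hB : ∀ t, 0 ≤ t → ‖(X t).1‖ ≤ B) :
    ∃ θe : Fin 2 → ℝ, ChiangThreeMachine.IsEquilibrium (θe 0, θe 1) ∧ Tendsto X atTop (𝓝 (θe, 0)) := by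
  obtain ⟨θe, he, h⟩ := printedSystem.tendsto_equilibrium_of_angles_bounded_of_finite printedSystem_C_symm
    printedSystem_M_pos printedSystem_D_pos printedSystem_finite_equilibria hX hB
  exact ⟨θe, (printedSystem_isEquilibrium_iff θe).1 he, h⟩

/-- **Chiang's Thm 3.1, pointwise dichotomy, for (4.1)**: every forward motion converges to an equilibrium point or leaves every
compact set of the phase space. [cite: Chiang1995, §3 Thm 3.1] -/
theorem printed_dichotomy {X : ℝ → (Fin 2 → ℝ) × (Fin 2 → ℝ)}
    (hX : ∀ T : ℝ, ∀ t ∈ Icc 0 T, HasDerivWithinAt X (printedSystem.field (X t)) (Icc 0 T) t) :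
    (∃ θe : Fin 2 → ℝ, ChiangThreeMachine.IsEquilibrium (θe 0, θe 1) ∧ Tendsto X atTop (𝓝 (θe, 0))) ∨
      ∀ K : Set ((Fin 2 → ℝ) × (Fin 2 → ℝ)), IsCompact K → ∃ t, 0 ≤ t ∧ X t ∉ K := by
  rcases printedSystem.tendsto_equilibrium_or_unbounded_of_finite printedSystem_C_symm printedSystem_M_pos
      printedSystem_D_pos printedSystem_finite_equilibria hX with ⟨θe, he, h⟩ | h
  · exact Or.inl ⟨θe, (printedSystem_isEquilibrium_iff θe).1 he, h⟩
  · exact Or.inr h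

end Chiang3

end Summit.Ventures.GridStability.Models

end

/-! ### (Append — rider «#133″ EVERY-MOTION», lead g9 RULING 9cj (3)(a)) EVERY motion of the PRINTED (4.1): `V → −∞` or convergence
### to ONE of the six equilibria — lit-1 g10's §7 of `FiniteEquilibriumSetIsolation` (p574925) BY NAME, no boundedness hypothesis

THREE COLUMNS.  CERTIFIED: for MODEL (4.1) as printed, from EVERY initial state the (unique) forward motion EITHER has energy
`V → −∞` with `Σᵢ Pᵢθᵢ → +∞` (loss of synchronism with the reference bus 3) OR converges to ONE equilibrium point `(θe, 0)` with
`ChiangThreeMachine.IsEquilibrium (θe 0, θe 1)` (exactly six modulo 2π by lit-1's kernel census p566261).  VALIDATED / MODELLED: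
nothing new; no sentence says a machine or the system is stable.  [cite: Chiang1995, §3 Thm 3.1 («hyperbolic» replaced by the finite
census), §4.1 eq. (4.1)] -/

noncomputable section

open Set Filter Topology
open Literature.MathematicalPhysics.PowerSystems

namespace Summit.Ventures.GridStability.Models

namespace Chiang3

/-- **«#133″ EVERY-MOTION» — Chiang's Thm 3.1 for the PRINTED (4.1) along EVERY forward motion, hyperbolicity replaced by the
kernel census** (lit-1's `LosslessSystem.tendsto_energy_atBot_or_tendsto_equilibrium_of_finite` by name): EITHER the energy
`printedSystem.energy (X t) → −∞` with `Σᵢ Pᵢ θᵢ(t) → +∞` (loss of synchronism with the reference bus) OR the motion converges to ONE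
equilibrium point `(θe, 0)`, `θe` one of the six census equilibria modulo 2π — no boundedness, cohesiveness or isolation hypothesis.
[cite: Chiang1995, §3 Thm 3.1, §4.1 eq. (4.1)] -/
theorem printed_tendsto_energy_atBot_or_tendsto_equilibrium {X : ℝ → (Fin 2 → ℝ) × (Fin 2 → ℝ)}
    (hX : ∀ T : ℝ, ∀ t ∈ Icc 0 T, HasDerivWithinAt X (printedSystem.field (X t)) (Icc 0 T) t) :
    (Tendsto (fun t => printedSystem.energy (X t)) atTop atBot ∧
        Tendsto (fun t => ∑ i, printedSystem.P i * (X t).1 i) atTop atTop) ∨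
      ∃ θe : Fin 2 → ℝ, ChiangThreeMachine.IsEquilibrium (θe 0, θe 1) ∧ Tendsto X atTop (𝓝 (θe, 0)) := by
  rcases printedSystem.tendsto_energy_atBot_or_tendsto_equilibrium_of_finite printedSystem_C_symm printedSystem_M_pos
      printedSystem_D_pos printedSystem_finite_equilibria hX with h | ⟨θe, he, h⟩
  · exact Or.inl h
  · exact Or.inr ⟨θe, (printedSystem_isEquilibrium_iff θe).1 he, h⟩

/-- **«#133″ EVERY-MOTION» from EVERY INITIAL STATE** (the forward motion exists — and is unique, lit-6 `globalSolution_unique`;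
lit-1's `LosslessSystem.dichotomy_of_initialState_of_finite` by name): for every `x₀` there is a forward motion of the PRINTED (4.1)
from `x₀`, and it EITHER loses synchronism (`V → −∞`, `Σᵢ Pᵢ θᵢ → +∞`) OR converges to ONE of the six equilibrium points.
[cite: Chiang1995, §3 Thm 3.1, §4.1 eq. (4.1)] -/
theorem printed_dichotomy_of_initialState (x₀ : (Fin 2 → ℝ) × (Fin 2 → ℝ)) :
    ∃ X : ℝ → (Fin 2 → ℝ) × (Fin 2 → ℝ), X 0 = x₀ ∧
      (∀ T : ℝ, ∀ t ∈ Icc 0 T, HasDerivWithinAt X (printedSystem.field (X t)) (Icc 0 T) t) ∧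
      ((Tendsto (fun t => printedSystem.energy (X t)) atTop atBot ∧
          Tendsto (fun t => ∑ i, printedSystem.P i * (X t).1 i) atTop atTop) ∨
        ∃ θe : Fin 2 → ℝ, ChiangThreeMachine.IsEquilibrium (θe 0, θe 1) ∧ Tendsto X atTop (𝓝 (θe, 0))) := by
  obtain ⟨X, h0, hX, -⟩ := printedSystem.dichotomy_of_initialState_of_finite printedSystem_C_symm printedSystem_M_pos
      printedSystem_D_pos printedSystem_finite_equilibria x₀
  exact ⟨X, h0, hX, printed_tendsto_energy_atBot_or_tendsto_equilibrium hX⟩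

end Chiang3

end Summit.Ventures.GridStability.Models

end
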